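import Mathlib
import Summits.KontsevichZagierPeriods.Zeta5Search.CasoratianValuation
import HarnessLib

/-!
# ζ(5) search — residue-class ("cluster") valuation theory for the partial fractions of `R_b`:
# FINAL STATEMENT FORMS (gen-2 g8; filed by typer g7 in three parts — this is part 1, §1–§3; §4 = `ClusterValuationResidues.lean`, §5 = `ClusterValuationChecks.lean`)

Cell `pub-zeta5`; HONEST FRAMING: systematic search; no irrationality claim unless certified.
STATEMENTS (plus a few lines of proved algebra), staged as `HOME/lean/G8ClusterValuation.lean` (sha256 6eae9a9156b3a6db…) and
filed verbatim under `Zeta5Search/ClusterValuation*.lean` (lead ruling 2026-08-20T08:36Z).  Paper proofs: REPORT-gen2-g6 §2–§4 (Theorems A, B, C),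
REPORT-gen2-g7 §1 (the floor inequality (T1)), REPORT-gen2-g8 §1–§3 (global residue split, exact check tables).

## Coordinates (as `BigPrimePoles` / `WedgeDictionary.pfData`)
`n = b₀`; positions `q ∈ [0,n]` ↔ the factor `(y+q)`, `y = t+1`; `pfData b o q` is the coefficient of `(y+q)^{-(o+1)}`.
Blocks `block n β_j = [β_j, n−β_j]` (`β_j = b_{j}`, `j = 1..7`); the depth of `q` is `blockCount b q = #{j : q ∈ block_j}`;
`R_b(y) = 2·(y + n/2)·∏_{q=0}^{n} (y+q)^{1 − blockCount q}`.  NET EXPONENT `netExp b q = 1 − blockCount q + [2q = n]`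
(for even `n` the simple zero `y + n/2` of the very-well-poised factor sits ON the lattice point `q = n/2` and is merged; for odd
`n` it is a separate simple zero at the half-integer position `n/2`).  `q` is a POLE iff `netExp b q < 0`, of order `−netExp b q`.
(Change w.r.t. G6: `classPoles` there counted `blockCount ≥ 2`, which mis-counts the even centre of depth 2 — a regular point.
All statements below use `netExp`; this is the convention of `g6/floorineq.py::pb_comb`, against which (T1) was checked
exhaustively for b₀ ≤ 25 and proved on paper.)

For an odd prime `p` with `p ≤ n < p² − 2` (the WINDOW) the class of `x` is `{q ≤ n : q ≡ x (mod p)}`; its LEVELS are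
`ℓ_q = (q − x)/p ∈ [0, p)` (so two class points differ by a unit multiple of `p`), the centre `n/2` lies in the class of `x` iff
`p ∣ 2x − n`, and the CLASS EXPONENT is `E_x = classExp b p x = Σ_{q ∈ class} netExp q + [n odd ∧ centre ∈ class]`.

## Contents
§1 computable class data; §2 the class bound `T_x(s)` of g6/g7 (with the palindrome bonus) and the FLOOR INEQUALITY (T1) in
case form (no `Option`/`min`): `LawWLeOne`, `LawWNonpos`, `FloorInequalityW`, `LawUNonpos`, `FloorInequalityU`;
§3 Theorems A / A′ / B (leading digit, with the explicit class cofactor `classRho` and unit `gHat`) / C; the class pieces of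
`V = coeffV` (`ClassVBound`, `ZeroEvaluation` = g7 §2.3/§2.4); §4 (NEW, g8) the GLOBAL RESIDUE SPLIT
`W = Ω_p(b) − 𝒦_p(b)` with `Ω_p(b) = Σ_q Res (t^p−t)² R_b = μ_{2p+1} − 2μ_{p+2} + μ_3` (moments of `R_b` at `∞`, which VANISH for
`p ≤ d+1` by a degree count) — PROVED here as algebra over `pfData` — the induced split of the Casoratian, and the two OBSERVED laws
(`ConstantTermFloorLaw` = (V-floor), `KResCasoratianLaw` = (CV-𝒦)) which together with `MomentVanishing`/`MomentIntegral` imply (CV)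
(`CasoratianValuationLaw`) — this reduction `CVRoad` is PROVED here (`cvRoad`, `casoratianValuationLaw_of`) — and EXPLAIN its
refund `[p ≤ d]` as `Ω_p(b+e_j) = 0`; §5 `#guard` cross-checks of the §1–§2 definitions
against the exact tables of REPORT-gen2-g8 §3 (values produced independently by `g6/floorineq.py::pb_comb`).
-/

open Finset

namespace Summit.KontsevichZagierPeriods.Zeta5Search.ClusterValuation

open Summit.KontsevichZagierPeriods.Zeta5Search.DualSeries (InBox)
open Summit.KontsevichZagierPeriods.Zeta5Search.WedgeDictionary (coeffU coeffW coeffV pfData dOf)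
open Summit.KontsevichZagierPeriods.Zeta5Search.CasoratianValuation (InPolytope pairFloors refund refundW topPartners
  shift casoratian CasoratianValuationLaw)
open Summit.KontsevichZagierPeriods.Zeta5Search.BigPrime (block)

/-! ## §1 Computable class data -/

/-- Depth of the position `q`: the number of blocks `[b_j, b₀ − b_j]` containing it. -/
def blockCount (b : ℕ → ℤ) (q : ℕ) : ℕ :=
  ((range 7).filter fun j => q ∈ block (b 0).toNat (b (j + 1)).toNat).card

/-- Net exponent of `(y+q)` in `R_b`: `1 − depth`, plus `1` at the even centre `2q = b₀`. Poles are the `q` with `netExp < 0`. -/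
def netExp (b : ℕ → ℤ) (q : ℕ) : ℤ :=
  1 - (blockCount b q : ℤ) + (if 2 * (q : ℤ) = b 0 then 1 else 0)

/-- The residue class of `x` modulo `p` among the positions `0..b₀`. -/
def classSet (b : ℕ → ℤ) (p x : ℕ) : Finset ℕ :=
  (range ((b 0).toNat + 1)).filter fun s => s % p = x % p

/-- The centre `b₀/2` (doubled position `b₀`) lies in the class of `x` modulo the odd prime `p`. -/
def CentreIn (b : ℕ → ℤ) (p x : ℕ) : Prop := (p : ℤ) ∣ 2 * (x : ℤ) - b 0

/-- `CentreIn` is decidable. -/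
instance (b : ℕ → ℤ) (p x : ℕ) : Decidable (CentreIn b p x) := by unfold CentreIn; infer_instance

/-- Class exponent `E_x`: net exponent of the whole residue class (the odd centre contributes `+1` when it lies in the class). -/
def classExp (b : ℕ → ℤ) (p x : ℕ) : ℤ :=
  (∑ s ∈ classSet b p x, netExp b s) + (if ¬ (2 : ℤ) ∣ b 0 ∧ CentreIn b p x then 1 else 0)

/-- Number of poles (positions of negative net exponent) in the class of `x`. -/
def classPoleCount (b : ℕ → ℤ) (p x : ℕ) : ℕ := ((classSet b p x).filter fun s => netExp b s < 0).card

/-- The class of `x` contains a pole of order at least `s`. -/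
def HasPoleOfOrder (b : ℕ → ℤ) (p x s : ℕ) : Prop := ∃ q ∈ classSet b p x, netExp b q ≤ -(s : ℤ)

/-- `HasPoleOfOrder` is decidable. -/
instance (b : ℕ → ℤ) (p x s : ℕ) : Decidable (HasPoleOfOrder b p x s) := by unfold HasPoleOfOrder; infer_instance

/-- The level configuration of the class of `x` in DOUBLED absolute positions: `{(2q, netExp q) : q ∈ class, netExp q ≠ 0}`,
plus `(b₀, 1)` for the odd centre when it lies in the class.  (Palindromicity is translation invariant, so absolute positions
serve as well as levels.) -/
def classConfig (b : ℕ → ℤ) (p x : ℕ) : Finset (ℤ × ℤ) :=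
  (((classSet b p x).filter fun s => netExp b s ≠ 0).image fun s => (((2 * s : ℕ) : ℤ), netExp b s))
    ∪ (if ¬ (2 : ℤ) ∣ b 0 ∧ CentreIn b p x then {(b 0, 1)} else ∅)

/-- A configuration is PALINDROMIC if it is symmetric under a reflection `P ↦ m − P` (necessarily `m = min + max`); the
bounded quantifier keeps it decidable (for `S = ∅` it reads `False`, immaterial: only classes with poles are used). -/
def IsPalindromic (S : Finset (ℤ × ℤ)) : Prop :=
  ∃ m ∈ (S ×ˢ S).image (fun ab => ab.1.1 + ab.2.1), ∀ pe ∈ S, (m - pe.1, pe.2) ∈ S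

/-- `IsPalindromic` is decidable. -/
instance (S : Finset (ℤ × ℤ)) : Decidable (IsPalindromic S) := by unfold IsPalindromic; infer_instance

/-! ## §2 The class bound and the floor inequality (T1) -/

/-- g6/g7's class bound `T_x(s)` for pole ORDER `s` (`s = 3`: the ζ(3)-coefficient `W = Σ_q c_{2,q}`; `s = 5`: `U = Σ_q c_{4,q}`):
for a class with at least two poles `s + E_x`, plus the PALINDROME BONUS `1` when the configuration is palindromic and `s + E_x` is
odd (Theorem B: the leading digits of the class then cancel in conjugate pairs); for a class with at most one pole `max(s + E_x, 0)`
(Theorem A′). -/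
def classBound (b : ℕ → ℤ) (p x s : ℕ) : ℤ :=
  if 2 ≤ classPoleCount b p x then
    (s : ℤ) + classExp b p x
      + (if IsPalindromic (classConfig b p x) ∧ Odd ((s : ℤ) + classExp b p x) then 1 else 0)
  else max ((s : ℤ) + classExp b p x) 0

/-- Hypothesis `H(s)` of Theorem C: every class with at least two poles has `s + E_x ≥ 1`. -/
def GoodClasses (b : ℕ → ℤ) (p s : ℕ) : Prop :=
  ∀ x, x < p → 2 ≤ classPoleCount b p x → 1 ≤ (s : ℤ) + classExp b p x

/-- `GoodClasses` is decidable. -/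
instance (b : ℕ → ℤ) (p s : ℕ) : Decidable (GoodClasses b p s) := by unfold GoodClasses; infer_instance

/-- The right-hand side of (WV) (`Zeta3CoefficientValuationLaw`): `law_W = min(1,⌊(d+1)/p⌋) + a_p − N_p`. -/
noncomputable def lawW (b : ℕ → ℤ) (p : ℕ) : ℤ := refundW b p + topPartners b p - pairFloors b p

/-- The right-hand side of the `U`-law / (P̂V): `law_U = min(1,⌊d/p⌋) − 1 − N_p`. -/
def lawU (b : ℕ → ℤ) (p : ℕ) : ℤ := refund b p - 1 - pairFloors b p

/-- **(T1-i), PROVED ON PAPER** (REPORT-gen2-g7 §1, "a ≤ Σ_k N_{1k} ≤ N"): `law_W ≤ 1`. -/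
@[conjecture] def LawWLeOne : Prop :=
  ∀ (b : ℕ → ℤ) (p : ℕ), InPolytope b → 5 ≤ p → lawW b p ≤ 1

/-- **(T1-ii), PROVED ON PAPER** (ibid.): outside the critical range, `p > d(b)+1`, the refund vanishes and `law_W ≤ 0`. -/
@[conjecture] def LawWNonpos : Prop :=
  ∀ (b : ℕ → ℤ) (p : ℕ), InPolytope b → 5 ≤ p → dOf b + 1 < (p : ℤ) → lawW b p ≤ 0

/-- **(T1-iii) FLOOR INEQUALITY for `W`, PROVED ON PAPER** (REPORT-gen2-g7 §1 Steps 1–3; exhaustive machine check b₀ ≤ 25,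
1.9·10⁶ (b,p) pairs, and 5.0·10⁶ sampled triples, 0 violations): in the window `5 ≤ p ≤ b₀ < p² − 2`, if `H(3)` fails then
`law_W ≤ T_x(3)` for EVERY class `x` containing a pole of order ≥ 3.  Together with (T1-i/ii) this is `law_W ≤ PB'_3` for g6's
combinatorial bound `PB'_3 = max(min_x T_x(3), C_3)`.  Primality of `p` is not used (only `p` odd, `p ≥ 5`). -/
@[conjecture] def FloorInequalityW : Prop :=
  ∀ (b : ℕ → ℤ) (p x : ℕ), InPolytope b → 5 ≤ p → ¬ 2 ∣ p → (p : ℤ) ≤ b 0 → (b 0 + 2 : ℤ) < (p : ℤ) ^ 2 →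
    ¬ GoodClasses b p 3 → x < p → HasPoleOfOrder b p x 3 → lawW b p ≤ classBound b p x 3

/-- **(T1-iv), trivial**: `law_U ≤ 0` (`refund ≤ 1`, `N_p ≥ 0`). -/
@[conjecture] def LawUNonpos : Prop :=
  ∀ (b : ℕ → ℤ) (p : ℕ), InPolytope b → 5 ≤ p → lawU b p ≤ 0

/-- **(T1-v) FLOOR INEQUALITY for `U`, PROVED ON PAPER** (REPORT-gen2-g7 §1 Steps 1, 2, 4): in the window, `law_U ≤ T_x(5)` for
EVERY class `x` (for a class with ≥ 2 poles even `T_x(5) − law_U ≥ 2`; classes with ≤ 1 pole have `T_x(5) ≥ 0 ≥ law_U`).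
No hypothesis `¬H(5)` and no pole-order hypothesis is needed; the instance used by `PB'_5` is `HasPoleOfOrder b p x 5`. -/
@[conjecture] def FloorInequalityU : Prop :=
  ∀ (b : ℕ → ℤ) (p x : ℕ), InPolytope b → 5 ≤ p → ¬ 2 ∣ p → (p : ℤ) ≤ b 0 → (b 0 + 2 : ℤ) < (p : ℤ) ^ 2 →
    x < p → lawU b p ≤ classBound b p x 5

/-! ## §3 Theorems A, A′, B, C and the class pieces of `V` -/

/-- **THEOREM A (cluster bound), PROVED ON PAPER** (REPORT-gen2-g6 §2; g8 re-check: 13,052 + 5,186 exact instances, 0 failures):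
in the window `p² > b₀+2`, `v_p(c_{o,q}) ≥ (o+1) + E_{class(q)}` for every pole `q`. -/
@[conjecture] def ClusterBound : Prop :=
  ∀ (b : ℕ → ℤ) (p q o : ℕ), InPolytope b → p.Prime → 3 ≤ p → (b 0 + 2 : ℤ) < (p : ℤ) ^ 2 →
    q ≤ (b 0).toNat → o < 6 → pfData b o q ≠ 0 →
      (o : ℤ) + 1 + classExp b p q ≤ padicValRat p (pfData b o q)

/-- **THEOREM A′ (an isolated pole is `p`-integral), PROVED ON PAPER** (REPORT-gen2-g6 §2): if `q` is the only pole of its class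
(`p² > b₀+2`), every `c_{o,q}` is `p`-integral. -/
@[conjecture] def IsolatedPoleIntegral : Prop :=
  ∀ (b : ℕ → ℤ) (p q o : ℕ), InPolytope b → p.Prime → 3 ≤ p → (b 0 + 2 : ℤ) < (p : ℤ) ^ 2 →
    q ≤ (b 0).toNat → o < 6 → pfData b o q ≠ 0 → classPoleCount b p q = 1 →
      0 ≤ padicValRat p (pfData b o q)

/-- The binomial series `(δ + ε)^e = Σ_j C(e,j) δ^{e−j} ε^j` (`e : ℤ`, `δ ≠ 0`), as a formal power series in `ε`. -/
noncomputable def binomSeries (δ : ℚ) (e : ℤ) : PowerSeries ℚ :=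
  PowerSeries.mk fun j => (Ring.choose e j : ℚ) * δ ^ (e - j)

/-- The CLASS COFACTOR at the pole `q`: with levels `ℓ_s = (s − x)/p`, the class function is
`Φ_x(η) = ∏_{s ∈ class} (η − ℓ_s)^{netExp s} · [(η − ℓ_c)]` and `Φ_x(ℓ_q + ε) = ε^{netExp q} · G_q(ε)` with
`G_q(ε) = ∏_{s ∈ class, s ≠ q} ((q − s)/p + ε)^{netExp s} · [((q − b₀/2)/p + ε)]` (the bracket only for the odd centre in the class). -/
noncomputable def classCofactor (b : ℕ → ℤ) (p q : ℕ) : PowerSeries ℚ :=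
  (∏ s ∈ (classSet b p q).erase q, binomSeries (((q : ℚ) - s) / p) (netExp b s))
    * (if ¬ (2 : ℤ) ∣ b 0 ∧ CentreIn b p q then binomSeries (((q : ℚ) - (b 0 : ℚ) / 2) / p) 1 else 1)

/-- `ρ_{q,σ}` := the coefficient of `(η − ℓ_q)^{−σ}` in the partial-fraction expansion of `Φ_x` at `ℓ_q`
(`= [ε^{n_q − σ}] G_q(ε)`, `n_q = −netExp q` the pole order). -/
noncomputable def classRho (b : ℕ → ℤ) (p q σ : ℕ) : ℚ :=
  PowerSeries.coeff ((-netExp b q).toNat - σ) (classCofactor b p q)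

/-- The unit `ĝ_q = 2 · ∏_{s ∉ class(q)} (s − q)^{netExp s} · [(b₀/2 − q)]` (the bracket only for the odd centre outside the class):
the value at the pole of the product of all factors of `R_b` foreign to the class.  `ĝ_q ≡ ḡ_x (mod p)`. -/
noncomputable def gHat (b : ℕ → ℤ) (p q : ℕ) : ℚ :=
  2 * (∏ s ∈ (range ((b 0).toNat + 1)).filter (fun s => s % p ≠ q % p), ((s : ℚ) - q) ^ (netExp b s))
    * (if ¬ (2 : ℤ) ∣ b 0 ∧ ¬ CentreIn b p q then (b 0 : ℚ) / 2 - q else 1)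

/-- **THEOREM B (leading digit), PROVED ON PAPER** (REPORT-gen2-g6 §2, g7 §2.3; the change of variable `y = −x − pη` gives the EXACT
identity `c_{σ−1,q} = (−p)^{σ+E_x} · [ε^{n_q−σ}](G_q(ε) · g_{x,q}(ε))` with `g_{x,q}(ε) = 2∏_{s∉x}((s−q) − pε)^{netExp s}·[…]`, whose
Taylor coefficients beyond `ĝ_q` are divisible by `p`; g8 re-check of exactly this recipe: 13,052 instances with nonzero
difference, 0 failures, 5,186 instances with difference 0):  `c_{σ−1,q} = (−p)^{σ+E_x}(ĝ_q ρ_{q,σ} + O(p))`. -/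
@[conjecture] def LeadingDigit : Prop :=
  ∀ (b : ℕ → ℤ) (p q σ : ℕ), InPolytope b → p.Prime → 5 ≤ p → (b 0 + 2 : ℤ) < (p : ℤ) ^ 2 →
    q ≤ (b 0).toNat → 1 ≤ σ → (σ : ℤ) ≤ -netExp b q →
      pfData b (σ - 1) q - (-(p : ℚ)) ^ ((σ : ℤ) + classExp b p q) * gHat b p q * classRho b p q σ ≠ 0 →
        (σ : ℤ) + classExp b p q + 1 ≤
          padicValRat p (pfData b (σ - 1) q - (-(p : ℚ)) ^ ((σ : ℤ) + classExp b p q) * gHat b p q * classRho b p q σ)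

/-- **THEOREM C for `W` (wrapped extension of (W∞)), PROVED ON PAPER** (REPORT-gen2-g6 §3): under `H(3)`, `W(b)` is `p`-integral,
and `p ∣ W(b)` whenever `p ≤ d(b)+1`.  (Via §4: `W = Ω_p − 𝒦_p`, `𝒦_p ≡ 0 (mod p)` under `H(3)` by Theorems A/A′, and `Ω_p(b) = 0`
for `p ≤ d+1` by `MomentVanishing`.) -/
@[conjecture] def WrappedDivisibilityW : Prop :=
  ∀ (b : ℕ → ℤ) (p : ℕ), InPolytope b → p.Prime → 5 ≤ p → (b 0 + 2 : ℤ) < (p : ℤ) ^ 2 →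
    GoodClasses b p 3 → coeffW b ≠ 0 →
      (if (p : ℤ) ≤ dOf b + 1 then (1 : ℤ) else 0) ≤ padicValRat p (coeffW b)

/-- **THEOREM C for `U`, PROVED ON PAPER** (REPORT-gen2-g6 §3): under `H(5)`, `U(b)` is `p`-integral, and `p ∣ U(b)` whenever
`4p ≤ 2d(b)+3` (equivalently `2p ≤ d(b)+1`: the moment `[t^{-1}](t^p−t)⁴R_b` vanishes). -/
@[conjecture] def WrappedDivisibilityU : Prop :=
  ∀ (b : ℕ → ℤ) (p : ℕ), InPolytope b → p.Prime → 5 ≤ p → (b 0 + 2 : ℤ) < (p : ℤ) ^ 2 →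
    GoodClasses b p 5 → coeffU b ≠ 0 →
      (if 4 * (p : ℤ) ≤ 2 * dOf b + 3 then (1 : ℤ) else 0) ≤ padicValRat p (coeffU b)

/-- The CLASS PIECE of the constant term: `V_x = Σ_{q ∈ class} Σ_{o<6} c_{o,q} H_q^{(o+1)}` (so `coeffV b = Σ_{x<p} classV b p x`
when `p ≤ b₀ + 1`). -/
noncomputable def classV (b : ℕ → ℤ) (p x : ℕ) : ℚ :=
  ∑ q ∈ classSet b p x, ∑ o ∈ range 6,
    pfData b o q * Literature.NumberTheory.Transcendental.BallRivoal.harm (o + 1) q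

/-- **CLASS `V`-BOUND (g7 §2.3), PROVED ON PAPER** modulo Theorem A (`v_p(H_q^{(σ)}) ≥ −σ` for `q < p²`; g8 check 1,246 + 1,971
classes): `v_p(V_x) ≥ E_x` for every class with a pole. -/
@[conjecture] def ClassVBound : Prop :=
  ∀ (b : ℕ → ℤ) (p x : ℕ), InPolytope b → p.Prime → 5 ≤ p → (b 0 + 2 : ℤ) < (p : ℤ) ^ 2 →
    x < p → 1 ≤ classPoleCount b p x → classV b p x ≠ 0 → classExp b p x ≤ padicValRat p (classV b p x)

/-- **ZERO EVALUATION (g7 §2.4), PROVED ON PAPER** (g8 check: 1,779 classes, 0 failures): if the class of `x` has a SINGLE pole `q`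
and no NEUTRAL point below it (every class point `s < q` has `netExp s ≠ 0`, i.e. is a zero), then `V_x` is `p`-integral although
`E_x` may be as low as `−6`.  This is the dominant denominator saving of `V` in the upper window. -/
@[conjecture] def ZeroEvaluation : Prop :=
  ∀ (b : ℕ → ℤ) (p x q : ℕ), InPolytope b → p.Prime → 5 ≤ p → (b 0 + 2 : ℤ) < (p : ℤ) ^ 2 →
    x < p → classPoleCount b p x = 1 → q ∈ classSet b p x → netExp b q < 0 →
      (∀ s ∈ classSet b p x, s < q → netExp b s ≠ 0) → classV b p x ≠ 0 → 0 ≤ padicValRat p (classV b p x)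

end Summit.KontsevichZagierPeriods.Zeta5Search.ClusterValuation
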